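import Literature.NumberTheory.Automorphic.AdelicAbsDetOnePlace
import Literature.NumberTheory.Automorphic.GLnAdelicStructure
import HarnessLib

/-!
# H413 · E-2 · SW2 (iii) · (S-1) glue — (θ) the norm of the INVERSE torus pair as a one-place idele

Cell `hodgecm-mathlib`, crux H413 (`stmt-HodgeConjecture-24833`), child line `Cruxes/H413/Lines/F0_E2SiegelWeilWeilRange.lean`,
`StubSW2` (iii), binder `hLD` of ★ `E2SWDilateBoundCM.hbd_CM` (composer F0P4-p01 (g3), spec
`F0/P4/S1-GLUE-SPEC.hbd_CM_of_letters`).  PROOF lane, `--supports stmt-HodgeConjecture-24833` (helper; closes nothing by itself).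
HC_CM is proved only modulo the 7 printed citations until rung 0 closes.

The (ζ) ONE-PLACE IDELE letter (A-p01) exports, for the torus scalar pair `(p₂, q₂)` of a one-place torus idele at the finite
place `v` with local norm `r ≠ 0`, the norm clause `p₂² − D q₂² = 1 − ι_v 1 + ι_v r` (`ι_v = adeleSingleHom F v`) and an inverse pair
`(p₂′, q₂′)` with `p₂p₂′ + D q₂q₂′ = 1`, `p₂q₂′ + q₂p₂′ = 0` (★ `UnitaryGroup.exists_torusTwistGL`'s `h1 h2`); the (η) NORM
EVALUATION ★ `UnitaryGroup.adelicAbsDet_torusTwist_inv_eq_normAbs_pow′` (B-p02, p811797) consumes the norm of the INVERSE pair as a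
`localUnits` idele: `↑(localUnits v (Units.mk0 s hs0)) = p₂′² − D q₂′²`.  This file is the 40-line bridge (θ):

* `coe_localUnits_eq` — `↑(localUnits v u) = 1 − ι_v 1 + ι_v u` (the ★ `RankinSelbergTorusIntegral.coe_localUnits_eq_one_add_adeleSingleHom`
  spelling `1 + ι_v (u − 1)`, re-proved in 8 lines to keep the import cone free of the Rankin–Selberg theory);
* `torusNorm_mul_torusNorm` — BRAHMAGUPTA: `(p₂² − D q₂²)(p₂′² − D q₂′²) = (p₂p₂′ + D q₂q₂′)² − D (p₂q₂′ + q₂p₂′)²`, hence `= 1` under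
  `h1 h2` (`torusNorm_mul_torusNorm_eq_one`);
* `localUnits_inv_eq_torusNorm_inv` ∕ `localUnits_mk0_inv_eq_torusNorm_inv` — uniqueness of inverses in `𝔸_F`:
  `↑(localUnits v (Units.mk0 r hr)⁻¹) = ↑(localUnits v (Units.mk0 r⁻¹ _)) = p₂′² − D q₂′²`;
* `adelicAbsDet_torusTwist_inv_eq_normAbs_inv_pow` — (η)+(θ) composed in the composer's wanted conclusion
  `adelicAbsDet (n+n) F Mt⁻¹ = (normAbs F_v r)⁻¹ ^ n`.

Weil (1964) n° 13: the module of the dilation `d₀(α)` is `|det α|`, here `|N_{E∕F}(V)|⁻ⁿ` at the one-place torus element of norm `r`.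
[cite: Weil1964, Chap. I n° 13 p. 160] [cite: TateThesis1967, §4.3]
-/

set_option autoImplicit false
-- the cell's `Summit.HodgeConjecture.HodgeConjecture.…` namespace repeats the summit name by design (D-0017 layout)
set_option linter.dupNamespace false

noncomputable section

namespace Summit.HodgeConjecture.HodgeConjecture.Cruxes.H413.E2SWSplitPlaceTorusNormInverse

open scoped NNReal MatrixGroups
open NumberField IsDedekindDomain
open Literature.NumberTheory.Automorphic Literature.NumberTheory.Automorphic.UnitaryGroup
open Literature.NumberTheory.GaloisRepresentations (ideleGroup localUnits localUnits_fst localUnits_snd_apply_self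
  finiteAdeleSingle_apply_of_ne)
open Literature.NumberTheory.GaloisRepresentations.IsNonarchimedeanLocalField

variable (F : Type) [Field F] [NumberField F] (v : HeightOneSpectrum (𝓞 F))

/-! ## (θ1) the one-place idele `localUnits v u` as the adele `1 − ι_v 1 + ι_v u` -/

/-- **`↑(localUnits v u) = 1 − ι_v 1 + ι_v u`**: the idele `(…, 1, u, 1, …)` at the finite place `v` is the adele `1 − ι_v 1 + ι_v u`
(`ι_v = adeleSingleHom F v`, the non-unital factor inclusion `F_v → 𝔸_F`; both sides are `1` at infinity and at every finite `w ≠ v`, and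
`u` at `v`).  Same content as ★ `RankinSelbergTorusIntegral.coe_localUnits_eq_one_add_adeleSingleHom` (`= 1 + ι_v (u − 1)`).
[cite: TateThesis1967, §4.3] -/
theorem coe_localUnits_eq (u : (v.adicCompletion F)ˣ) :
    ((localUnits v u : ideleGroup F) : AdeleRing (𝓞 F) F) =
      1 - adeleSingleHom F v 1 + adeleSingleHom F v (u : v.adicCompletion F) := by
  refine Prod.ext ?_ (FiniteAdeleRing.ext F fun w => ?_)
  · change (1 : InfiniteAdeleRing F) = ((1 : AdeleRing (𝓞 F) F) - adeleSingleHom F v 1).1 + (adeleSingleHom F v _).1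
    change (1 : InfiniteAdeleRing F) = (1 : AdeleRing (𝓞 F) F).1 - (adeleSingleHom F v 1).1 + (adeleSingleHom F v _).1
    rw [adeleSingleHom_apply_fst, adeleSingleHom_apply_fst, sub_zero, add_zero]
    rfl
  · change ((localUnits v u : ideleGroup F) : AdeleRing (𝓞 F) F).2 w =
      AdelicGroupData.adeleEval F w (1 - adeleSingleHom F v 1 + adeleSingleHom F v _)
    by_cases hw : w = v
    · subst hw
      rw [localUnits_snd_apply_self, map_add, map_sub, map_one, adeleEval_adeleSingleHom, adeleEval_adeleSingleHom,
        sub_self, zero_add]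
    · rw [map_add, map_sub, map_one, adeleEval_adeleSingleHom_of_ne F v _ hw, adeleEval_adeleSingleHom_of_ne F v _ hw,
        sub_zero, add_zero]
      exact finiteAdeleSingle_apply_of_ne _ hw

/-- `Units.mk0 r⁻¹ _ = (Units.mk0 r hr)⁻¹` in `F_vˣ`. [folklore] -/
private theorem mk0_inv_eq {r : v.adicCompletion F} (hr : r ≠ 0) :
    Units.mk0 r⁻¹ (inv_ne_zero hr) = (Units.mk0 r hr)⁻¹ :=
  Units.ext (by rw [Units.val_mk0, Units.val_inv_eq_inv_val, Units.val_mk0])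

/-! ## (θ2) Brahmagupta: the torus norm is multiplicative -/

/-- **BRAHMAGUPTA'S IDENTITY** for the torus norm `N(p, q) = p² − D q²` in any commutative ring:
`N(p₂, q₂) · N(p₂′, q₂′) = (p₂p₂′ + D q₂q₂′)² − D (p₂q₂′ + q₂p₂′)²` (multiplicativity of `N_{E∕F}` on `V = p + qδ`, `δ² = D`).
[cite: Weil1964, Chap. I n° 13 p. 160] -/
theorem torusNorm_mul_torusNorm {R : Type*} [CommRing R] (D p₂ q₂ p₂' q₂' : R) :
    (p₂ * p₂ - D * (q₂ * q₂)) * (p₂' * p₂' - D * (q₂' * q₂')) =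
      (p₂ * p₂' + D * (q₂ * q₂')) * (p₂ * p₂' + D * (q₂ * q₂')) - D * ((p₂ * q₂' + q₂ * p₂') * (p₂ * q₂' + q₂ * p₂')) := by
  ring

/-- Under the inverse-pair relations `p₂p₂′ + D q₂q₂′ = 1`, `p₂q₂′ + q₂p₂′ = 0` (★ `exists_torusTwistGL`'s `h1 h2`) the norms are mutually
inverse: `N(p₂, q₂) · N(p₂′, q₂′) = 1`. [cite: Weil1964, Chap. I n° 13 p. 160] -/
theorem torusNorm_mul_torusNorm_eq_one {R : Type*} [CommRing R] {D p₂ q₂ p₂' q₂' : R}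
    (h1 : p₂ * p₂' + D * (q₂ * q₂') = 1) (h2 : p₂ * q₂' + q₂ * p₂' = 0) :
    (p₂ * p₂ - D * (q₂ * q₂)) * (p₂' * p₂' - D * (q₂' * q₂')) = 1 := by
  rw [torusNorm_mul_torusNorm, h1, h2, mul_one, mul_zero, mul_zero, sub_zero]

/-! ## (θ3) the norm of the inverse pair is the inverse one-place idele -/

/-- **(θ) THE NORM OF THE INVERSE TORUS PAIR IS THE ONE-PLACE IDELE OF `r⁻¹`**: if `N(p₂, q₂) = 1 − ι_v 1 + ι_v r` (the (ζ) norm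
clause: the one-place adele of `r ≠ 0` at `v`) and `(p₂′, q₂′)` is an inverse pair (`h1 h2`), then
`N(p₂′, q₂′) = ↑(localUnits v (Units.mk0 r hr))⁻¹ = ↑(localUnits v (Units.mk0 r hr)⁻¹)` — uniqueness of inverses in `𝔸_F`
(`Units.inv_eq_of_mul_eq_one_right`) applied to Brahmagupta. [cite: Weil1964, Chap. I n° 13 p. 160] -/
theorem localUnits_inv_eq_torusNorm_inv {D p₂ q₂ p₂' q₂' : AdeleRing (𝓞 F) F} {r : v.adicCompletion F}
    (h1 : p₂ * p₂' + D * (q₂ * q₂') = 1) (h2 : p₂ * q₂' + q₂ * p₂' = 0)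
    (hN : p₂ * p₂ - D * (q₂ * q₂) = 1 - adeleSingleHom F v 1 + adeleSingleHom F v r) (hr : r ≠ 0) :
    ((localUnits v (Units.mk0 r hr)⁻¹ : ideleGroup F) : AdeleRing (𝓞 F) F) = p₂' * p₂' - D * (q₂' * q₂') := by
  rw [map_inv]
  refine Units.inv_eq_of_mul_eq_one_right ?_
  rw [coe_localUnits_eq F v, Units.val_mk0, ← hN]
  exact torusNorm_mul_torusNorm_eq_one h1 h2

/-- The same in the `Units.mk0 r⁻¹` spelling of ★ `adelicAbsDet_torusTwist_inv_eq_normAbs_pow′`'s hypothesis `hs` (with `s := r⁻¹`,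
`hs0 := inv_ne_zero hr`): `↑(localUnits v (Units.mk0 r⁻¹ _)) = N(p₂′, q₂′)`. [cite: Weil1964, Chap. I n° 13 p. 160] -/
theorem localUnits_mk0_inv_eq_torusNorm_inv {D p₂ q₂ p₂' q₂' : AdeleRing (𝓞 F) F} {r : v.adicCompletion F}
    (h1 : p₂ * p₂' + D * (q₂ * q₂') = 1) (h2 : p₂ * q₂' + q₂ * p₂' = 0)
    (hN : p₂ * p₂ - D * (q₂ * q₂) = 1 - adeleSingleHom F v 1 + adeleSingleHom F v r) (hr : r ≠ 0) :
    ((localUnits v (Units.mk0 r⁻¹ (inv_ne_zero hr)) : ideleGroup F) : AdeleRing (𝓞 F) F) =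
      p₂' * p₂' - D * (q₂' * q₂') := by
  rw [mk0_inv_eq F v hr]
  exact localUnits_inv_eq_torusNorm_inv F v h1 h2 hN hr

/-- The forward clause in `localUnits` currency: `N(p₂, q₂) = ↑(localUnits v (Units.mk0 r hr))`. [cite: TateThesis1967, §4.3] -/
theorem torusNorm_eq_localUnits {D p₂ q₂ : AdeleRing (𝓞 F) F} {r : v.adicCompletion F}
    (hN : p₂ * p₂ - D * (q₂ * q₂) = 1 - adeleSingleHom F v 1 + adeleSingleHom F v r) (hr : r ≠ 0) :
    p₂ * p₂ - D * (q₂ * q₂) = ((localUnits v (Units.mk0 r hr) : ideleGroup F) : AdeleRing (𝓞 F) F) := by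
  rw [coe_localUnits_eq F v, Units.val_mk0, hN]

/-! ## (η)+(θ) composed: the modulus clause of `hLD` -/

/-- **(η)+(θ) THE MODULUS OF THE INVERSE TORUS TWIST IS `|r|_v⁻ⁿ`**: for the torus twist `Mt` with `↑Mt⁻¹ = M(p₂′, q₂′)`
(★ `exists_torusTwistGL`), `(p₂′, q₂′)` the inverse pair of `(p₂, q₂)` (`h1 h2`) and `N(p₂, q₂)` the one-place adele of `r ≠ 0` at `v`
(the (ζ) norm clause), `adelicAbsDet (n+n) F Mt⁻¹ = (|r|_v)⁻¹ ^ n` — ★ `adelicAbsDet_torusTwist_inv_eq_normAbs_pow′` (B-p02) at the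
idele of (θ), then `|r⁻¹|_v = |r|_v⁻¹`.  The `L q` clause of the composed `hLD` of ★ `E2SWDilateBoundCM.hbd_CM` reads through (γ) ★
`l2Scaling_eq_of_omega_eq_twistLM`. [cite: Weil1964, Chap. I n° 13 p. 160] -/
theorem adelicAbsDet_torusTwist_inv_eq_normAbs_inv_pow {n : ℕ} (𝕋 : Matrix (Fin n) (Fin n) (AdeleRing (𝓞 F) F))
    (h𝕋 : IsUnit 𝕋.det) {D p₂ q₂ p₂' q₂' : AdeleRing (𝓞 F) F} (Mt : GL (Fin (n + n)) (AdeleRing (𝓞 F) F))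
    (hMt : ((Mt⁻¹ : GL (Fin (n + n)) (AdeleRing (𝓞 F) F)) : Matrix (Fin (n + n)) (Fin (n + n)) (AdeleRing (𝓞 F) F)) =
      Matrix.reindex finSumFinEquiv finSumFinEquiv
        (Matrix.fromBlocks (p₂' • (1 : Matrix (Fin n) (Fin n) (AdeleRing (𝓞 F) F))) (q₂' • 𝕋) ((D * q₂') • 𝕋⁻¹) (p₂' • 1)))
    {r : v.adicCompletion F} (h1 : p₂ * p₂' + D * (q₂ * q₂') = 1) (h2 : p₂ * q₂' + q₂ * p₂' = 0)
    (hN : p₂ * p₂ - D * (q₂ * q₂) = 1 - adeleSingleHom F v 1 + adeleSingleHom F v r) (hr : r ≠ 0) :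
    adelicAbsDet (n + n) F Mt⁻¹ = (normAbs (v.adicCompletion F) r)⁻¹ ^ n := by
  rw [adelicAbsDet_torusTwist_inv_eq_normAbs_pow' 𝕋 h𝕋 Mt hMt v (inv_ne_zero hr)
      (localUnits_mk0_inv_eq_torusNorm_inv F v h1 h2 hN hr), map_inv₀]

/-- The same, read as `|r⁻¹|_vⁿ` (the `(normAbs F_v s)^{card κ}` letter with `s := r⁻¹`). [cite: Weil1964, Chap. I n° 13 p. 160] -/
theorem adelicAbsDet_torusTwist_inv_eq_normAbs_pow_inv {n : ℕ} (𝕋 : Matrix (Fin n) (Fin n) (AdeleRing (𝓞 F) F))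
    (h𝕋 : IsUnit 𝕋.det) {D p₂ q₂ p₂' q₂' : AdeleRing (𝓞 F) F} (Mt : GL (Fin (n + n)) (AdeleRing (𝓞 F) F))
    (hMt : ((Mt⁻¹ : GL (Fin (n + n)) (AdeleRing (𝓞 F) F)) : Matrix (Fin (n + n)) (Fin (n + n)) (AdeleRing (𝓞 F) F)) =
      Matrix.reindex finSumFinEquiv finSumFinEquiv
        (Matrix.fromBlocks (p₂' • (1 : Matrix (Fin n) (Fin n) (AdeleRing (𝓞 F) F))) (q₂' • 𝕋) ((D * q₂') • 𝕋⁻¹) (p₂' • 1)))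
    {r : v.adicCompletion F} (h1 : p₂ * p₂' + D * (q₂ * q₂') = 1) (h2 : p₂ * q₂' + q₂ * p₂' = 0)
    (hN : p₂ * p₂ - D * (q₂ * q₂) = 1 - adeleSingleHom F v 1 + adeleSingleHom F v r) (hr : r ≠ 0) :
    adelicAbsDet (n + n) F Mt⁻¹ = normAbs (v.adicCompletion F) r⁻¹ ^ n :=
  adelicAbsDet_torusTwist_inv_eq_normAbs_pow' 𝕋 h𝕋 Mt hMt v (inv_ne_zero hr)
    (localUnits_mk0_inv_eq_torusNorm_inv F v h1 h2 hN hr)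

end Summit.HodgeConjecture.HodgeConjecture.Cruxes.H413.E2SWSplitPlaceTorusNormInverse
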